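import Literature.AlgebraicGeometry.Motives.AbelianVarietyWeilPairingPullback
import HarnessLib

/-!
# The adjunction `ē_N^Θ(e P, Q) = ē_N^Θ(P, e′ Q)` of the level Weil pairing for endomorphisms with `D^Θ_{e′Q} ∼ e^*D^Θ_Q`
# ([MumfordAV1970] §20 property (3), §23 p. 208 «`e^L(γx, y) = e^L(x, γ′y)`»; [Lang1983AbelianVarieties] VII §2 Prop. 2 (iii), Thm. 5)

Layer `Literature/AlgebraicGeometry/Motives`, namespace `Literature.AlgebraicGeometry.Motives.AbelianVariety`.
THEOREMS ONLY (no definition, no named fact, no instance, no `sorry`).  Cell `hodgecm-mathlib` (D-0151), P6 «MOD» (crux hLiu418 =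
stmt-HodgeConjecture-24832, `--supports`, count-neutral): line L3 ROOF road «DUAL-B̄», ISOTROPY organ, step **(ADJ) — the abelian-VARIETY half**:
the Rosati adjunction of the level Weil pairing `ē_N^Θ` (★ `weilPairingLevel`, `Motives/AbelianVarietyWeilPairingLevel`) from the
Weil-DIVISOR identity `D^Θ_{e′Q} ∼ e^*D^Θ_Q` (`D^Θ_Q = t_Q^*Θ − Θ`, ★ `weilDiv`), over ANY field.  The scheme half — that identity from the Rosati
row `e′ ≫ λ = λ ≫ e^∨` at a geometric point with `λ̄ = Λ(𝒪(Θ))` — is the converse of ★ `AbelianSchemes/RosatiAtPointOfWeilDivisorPullback` and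
lives in the sequel `AbelianSchemes/WeilDivisorPullbackOfRosatiAtPoint`.  HC_CM is proved only modulo the printed citations until rung 0 closes;
nothing here is about HC.

THE MATHEMATICS ([MumfordAV1970] §20 p. 186 property (3) «`e_n(f(x), ŷ) = e_n(x, f̂(ŷ))`»; [Lang1983AbelianVarieties] VII §2 Prop. 2 (iii)
«`e_n(a, α⁻¹(Y)) = e_n(αa, Y)`»).  Let `f : A → B` be a dominant homomorphism of abelian varieties over `K`, `[N]_A`, `[N]_B` dominant, `E` a
Cartier divisor on `B` with a trivializer `g` of `[N]_B^*E` (★ `IsTrivializer`), so that `f^♯g` trivializes `[N]_A^*f^*E` (★ `IsTrivializer.comp_hom`).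
Then the Kummer constants (★ `kummerConst`: `e_N(P, E) = t_P^♯ g ∕ g ∈ K`) satisfy the PROJECTION FORMULA

  **`e_N(P, f^*E) = e_N(f P, E)`**  (★ `AbelianVariety.kummerConst_comp_hom` of `Motives/JacobianNormAdjointOfNormPullback`, the calculation
  inside ★ `weilPairingLevel_pullback_eq`; re-proved here as a PRIVATE copy `kummerConst_comp_hom'` so that this generic file does not import the
  Jacobian-of-curves cone of that module).

Consequently, for endomorphisms `e`, `e′` of ONE abelian variety `X` (`e`
dominant) and `N`-torsion points `P`, `Q` with **`D^Θ_{e′Q} ∼ e^*D^Θ_Q`**: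
`ē^Θ_N(P, e′Q) = e_N(P, D^Θ_{e′Q}) = e_N(P, e^*D^Θ_Q)` (★ `weilPairingLevel_eq_kummerConst_of_linEquiv`: the pairing may be computed on any
linearly equivalent divisor with any trivializer) `= e_N(eP, D^Θ_Q) = ē^Θ_N(eP, Q)` — **`weilPairingLevel_map_eq_weilPairingLevel_map_of_weilDiv_linEquiv`**.
For the Rosati dual `e′ = γ′` of `e = γ` this is Mumford's «`e^L(γx, y) = e^L(x, γ′y)`» (§23 p. 208); for a CM action `ι` whose Rosati involution
is complex conjugation it reads `ē^Θ_N(ι(a)P, Q) = ē^Θ_N(P, ι(ā)Q)` ([Shimura1998] (18.4b)).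

* §1 (private) `kummerConst_comp_hom'` — the projection formula (copy of ★ `kummerConst_comp_hom`);
* §2 `weilPairingLevel_map_eq_weilPairingLevel_map_of_weilDiv_linEquiv` (subtype-packaged images), `…_eq` (equation binders `P′ = eP`, `Q′ = e′Q`),
  `weilPairingLevel_map_eq_of_forall_weilDiv_linEquiv` (hypothesis for all rational points `Q`).

## References
* [MumfordAV1970] D. Mumford, *Abelian Varieties* (1970), §20 p. 186 (property (3) of `e_n`), §23 p. 208 (`e^L(γx, y) = e^L(x, γ′y)`).
* [Lang1983AbelianVarieties] S. Lang, *Abelian Varieties*, Ch. VII §2, Prop. 2 (iii), Prop. 3, Thm. 5 (PDF pp. 138–142).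
* [Shimura1998] G. Shimura, *Abelian Varieties with Complex Multiplication and Modular Functions* (1998), (18.4b) p. 126.
-/

universe u

open CategoryTheory CategoryTheory.Limits AlgebraicGeometry MonoidalCategory CartesianMonoidalCategory

noncomputable section

namespace Literature.AlgebraicGeometry.Motives

open scoped MonObj
open RatFn

namespace AbelianVariety

variable {K : Type u} [Field K]

/-! ### §1 The Kummer projection formula `e_N(P, f^*E) = e_N(fP, E)` -/

section Projection

variable {A B : AbelianVariety K} (f : A ⟶ B) [IsDominant (Hom.toSchemeHom f)]
  {N : ℕ} [IsDominant (Hom.toSchemeHom ((N : ℤ) • 𝟙 A))] [IsDominant (Hom.toSchemeHom ((N : ℤ) • 𝟙 B))]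

/-- **Projection formula `e_N(P, f^*E) = e_N(f P, E)`** for a dominant homomorphism `f : A → B`, a Cartier divisor `E` on `B` with a trivializer `g`
of `[N]^*E`, computed with the transported trivializer `f^♯ g` of `[N]^*f^*E` (★ `IsTrivializer.comp_hom`): `t_P^♯ f^♯ g ∕ f^♯ g = f^♯(t_{fP}^♯ g ∕ g)`
(`t_P ≫ f = f ≫ t_{fP}`, ★ `translation_left_comp_toSchemeHom`) and `f^♯` fixes constants.  Private copy of ★ `AbelianVariety.kummerConst_comp_hom`
(`Motives/JacobianNormAdjointOfNormPullback`), whose module lies outside this file's import cone.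
[cite: MumfordAV1970, §20 (property (3) of e_n, p. 186)] [cite: Lang1983AbelianVarieties, Ch. VII §2 Prop. 2 (iii)] -/
private theorem kummerConst_comp_hom' {E : CartierDivisor B.X.left} {g : B.X.left.functionField} (hg : B.IsTrivializer (n := N) E g)
    (P : A.torsionPoints K N) :
    kummerConst (hg.comp_hom f) P = kummerConst hg ⟨AlgPoints.map f.hom.hom.hom P.1, map_mem_torsionPoints f P.2⟩ := by
  apply (algebraMap K A.X.left.functionField).injective
  rw [algebraMap_kummerConst]
  -- `t_P^♯ ∘ f^♯ = f^♯ ∘ t_{fP}^♯`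
  have ht := translation_left_comp_toSchemeHom f P.1
  haveI : IsDominant ((A.translation P.1).left ≫ Hom.toSchemeHom f) := inferInstance
  haveI : IsDominant (Hom.toSchemeHom f ≫ (B.translation (AlgPoints.map f.hom.hom.hom P.1)).left) := inferInstance
  have hFF : (functionFieldMap (A.translation P.1).left).comp (functionFieldMap (Hom.toSchemeHom f)) =
      (functionFieldMap (Hom.toSchemeHom f)).comp (functionFieldMap (B.translation (AlgPoints.map f.hom.hom.hom P.1)).left) := by
    have h := functionFieldMap_congr ht
    rw [functionFieldMap_comp, functionFieldMap_comp] at h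
    exact h
  change functionFieldMap (A.translation P.1).left (functionFieldMap (Hom.toSchemeHom f) g) / functionFieldMap (Hom.toSchemeHom f) g = _
  rw [← RingHom.comp_apply (functionFieldMap (A.translation P.1).left), hFF, RingHom.comp_apply, ← map_div₀]
  change functionFieldMap (Hom.toSchemeHom f) (B.translFF (AlgPoints.map f.hom.hom.hom P.1) g / g) = _
  rw [← algebraMap_kummerConst hg ⟨AlgPoints.map f.hom.hom.hom P.1, map_mem_torsionPoints f P.2⟩,
    functionFieldMap_toSchemeHom_algebraMap]

end Projection

/-! ### §2 The adjunction `ē^Θ_N(eP, Q) = ē^Θ_N(P, e′Q)` from `D^Θ_{e′Q} ∼ e^*D^Θ_Q` -/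

section Adjoint

variable {X : AbelianVariety K} (e e' : X ⟶ X) [IsDominant (Hom.toSchemeHom e)]
  {N : ℕ} [IsDominant (Hom.toSchemeHom ((N : ℤ) • 𝟙 X))]

/-- **`ē^Θ_N(e P, Q) = ē^Θ_N(P, e′ Q)` whenever `D^Θ_{e′Q} ∼ e^*D^Θ_Q`** — the adjunction of the level Weil pairing for a pair of endomorphisms
`e` (dominant), `e′` of an abelian variety that are ADJOINT ON WEIL DIVISORS at the `N`-torsion point `Q` (for the Rosati dual `e′` of `e` w.r.t.
`φ_Θ` this is [MumfordAV1970] §23 «`e^L(γx, y) = e^L(x, γ′y)`»).  Proof: `ē(P, e′Q) = e_N(P, D_{e′Q}) = e_N(P, e^*D_Q)` (any linearly equivalent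
divisor, any trivializer — ★ `weilPairingLevel_eq_kummerConst_of_linEquiv` with the trivializer `e^♯ g_Q`) `= e_N(eP, D_Q) = ē(eP, Q)` (§1).
[cite: MumfordAV1970, §20 property (3) (p. 186) and §23 (p. 208)] [cite: Lang1983AbelianVarieties, Ch. VII §2 Thm. 5] -/
theorem weilPairingLevel_map_eq_weilPairingLevel_map_of_weilDiv_linEquiv (Θ : CartierDivisor X.X.left) (P Q : X.torsionPoints K N)
    (h : (X.weilDiv Θ (AlgPoints.map e'.hom.hom.hom Q.1)).LinEquiv ((X.weilDiv Θ Q.1).pullback (Hom.toSchemeHom e))) :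
    X.weilPairingLevel Θ ⟨AlgPoints.map e.hom.hom.hom P.1, map_mem_torsionPoints e P.2⟩ Q =
      X.weilPairingLevel Θ P ⟨AlgPoints.map e'.hom.hom.hom Q.1, map_mem_torsionPoints e' Q.2⟩ := by
  have hg := X.isTrivializer_weilFn Θ Q
  rw [weilPairingLevel_eq_kummerConst_of_linEquiv (Q := ⟨AlgPoints.map e'.hom.hom.hom Q.1, map_mem_torsionPoints e' Q.2⟩)
      (hg.comp_hom e) h P, kummerConst_comp_hom' e hg P, weilPairingLevel_eq_kummerConst hg]

/-- The adjunction with equation binders: `P′ = eP`, `Q′ = e′Q`, `D^Θ_{Q′} ∼ e^*D^Θ_Q` ⇒ `ē^Θ_N(P′, Q) = ē^Θ_N(P, Q′)`.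
[cite: MumfordAV1970, §20 property (3) (p. 186) and §23 (p. 208)] -/
theorem weilPairingLevel_map_eq_weilPairingLevel_map_of_weilDiv_linEquiv_eq (Θ : CartierDivisor X.X.left) (P Q P' Q' : X.torsionPoints K N)
    (hP : (P' : X.Points K) = AlgPoints.map e.hom.hom.hom P) (hQ : (Q' : X.Points K) = AlgPoints.map e'.hom.hom.hom Q)
    (h : (X.weilDiv Θ Q'.1).LinEquiv ((X.weilDiv Θ Q.1).pullback (Hom.toSchemeHom e))) :
    X.weilPairingLevel Θ P' Q = X.weilPairingLevel Θ P Q' := by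
  obtain ⟨P'₀, hP'₀⟩ := P'
  obtain ⟨Q'₀, hQ'₀⟩ := Q'
  subst hP hQ
  exact weilPairingLevel_map_eq_weilPairingLevel_map_of_weilDiv_linEquiv e e' Θ P Q h

/-- The adjunction from the divisor identity at ALL rational points (the form the scheme half delivers: `D^Θ_{e′Q} ∼ e^*D^Θ_Q` for every
`Q ∈ X(K)`): `ē^Θ_N(P′, Q) = ē^Θ_N(P, Q′)` for `P′ = eP`, `Q′ = e′Q`. [cite: MumfordAV1970, §20 property (3) (p. 186) and §23 (p. 208)] -/
theorem weilPairingLevel_map_eq_of_forall_weilDiv_linEquiv (Θ : CartierDivisor X.X.left)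
    (h : ∀ Q : X.Points K, (X.weilDiv Θ (AlgPoints.map e'.hom.hom.hom Q)).LinEquiv ((X.weilDiv Θ Q).pullback (Hom.toSchemeHom e)))
    (P Q P' Q' : X.torsionPoints K N) (hP : (P' : X.Points K) = AlgPoints.map e.hom.hom.hom P)
    (hQ : (Q' : X.Points K) = AlgPoints.map e'.hom.hom.hom Q) :
    X.weilPairingLevel Θ P' Q = X.weilPairingLevel Θ P Q' :=
  weilPairingLevel_map_eq_weilPairingLevel_map_of_weilDiv_linEquiv_eq e e' Θ P Q P' Q' hP hQ (hQ ▸ h Q.1)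

end Adjoint

end AbelianVariety

end Literature.AlgebraicGeometry.Motives

end
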